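import Literature.Algebra.Lie.ChevalleyEilenbergLowDegree
import Literature.Algebra.Lie.ChevalleyEilenbergPostComposition
import Literature.Algebra.Lie.CasimirElement
import Mathlib.LinearAlgebra.TensorProduct.Basic
import HarnessLib

/-!
# The Casimir homotopy on the Chevalley–Eilenberg complex: Casimir operators and central
# elements act by zero on (relative, `(𝔤, K)`-) Lie algebra cohomology

Topic `Algebra/Lie`; namespace `Literature.Algebra.Lie.ChevalleyEilenberg` (continues
`ChevalleyEilenbergComplex`, `…LowDegree`, `…PostComposition`, `…Functoriality`). Definitions
with bodies and theorems only; no named fact, no `sorry`.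

Let `L` be a Lie algebra over a commutative ring `R`, `M` an `L`-module, `σ : L → End_R M` a
linear map which is EQUIVARIANT for the action `ρ` of `L` on `M` (`[ρ(x), σ(u)] = σ([x, u])`;
e.g. `σ = ρ`, or `σ = ρ_V ⊗ 1` on `M = V ⊗ E`), and `∑_s y_s ⊗ y'_s ∈ L ⊗ L` a finite tensor
INVARIANT under `L` (`∑_s [x, y_s] ⊗ y'_s + y_s ⊗ [x, y'_s] = 0`; e.g. the canonical tensor
`∑ᵢ bᵢ ⊗ bⁱ` of a non-degenerate invariant symmetric bilinear form, `sum_lie_basis_tmul_dualBasis_add`).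
Following [cite: ChevalleyEilenberg1948, §24] (there for `σ = ρ` and the Casimir operator of a
semisimple Lie algebra, proof of Theorem 24.1) put

* `casimirHomotopy σ y y' q : C^{q+1}(L; M) → C^q(L; M)`, `h f = ∑_s σ(y_s) ∘ i_{y'_s} f`;
* `casimirOp σ y y' = N = ∑_s σ(y_s) ρ(y'_s) ∈ End_R M`.

Main results (all by the Cartan calculus of `ChevalleyEilenbergComplex`: induction on the degree
through `i_y d = θ_y - d i_y`, `i_y θ_x = θ_x i_y - i_{[x,y]}`):

* `lieDer_post` — `θ_x (ψ ∘ f) = ψ ∘ θ_x f + [ρ(x), ψ] ∘ f` for an ARBITRARY linear `ψ`;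
* `lieDer_casimirHomotopy` — `θ_x h = h θ_x`; `ins_casimirHomotopy` — `i_x h = -h i_x`;
* **`d_casimirHomotopy_add`** — THE HOMOTOPY IDENTITY `d h + h d = N ∘ -` (and
  `casimirHomotopy_d_zero`: `h d = N ∘ -` in degree `0`);
* `toEnd_mul_casimirOp`, `casimirEndo` — `N` is an `L`-module endomorphism;
  `casimirHomotopy_mem_rel`, `casimirHomotopy_mem_gK` — `h` preserves the relative complex of a
  Lie subalgebra and, for a compatible group action under which `σ` is equivariant and the
  tensor is invariant, the `(𝔤, K)`-complex of `ChevalleyEilenbergFunctoriality`;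
* **`gKCohomologyMap_casimirEndo_eq_zero`** — the endomorphism of `H^q(𝔤, 𝔨, K; M)` induced by
  `N` is ZERO in every degree [cite: ChevalleyEilenberg1948, §24, Thm. 24.1 (proof)];
  [cite: BorelWallach2000, I §5.1];
* `lieDer_eq_post_toEnd_of_central`, **`gKCohomologyMap_centralEndo_eq_zero`** — a CENTRAL
  `z ∈ L` fixed by the group acts by zero on `H^q(𝔤, 𝔨, K; M)` (`θ_z = ρ(z) ∘ -` and Cartan's
  homotopy formula `θ_z = i_z d + d i_z`, [cite: BorelWallach2000, I §1.1 (5)]);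
* `sum_lie_basis_tmul_dualBasis_add`, `sum_map_basis_tmul_dualBasis`, `sum_dualBasis_tmul_basis`
  (namespace `Literature.Algebra.Lie`) — the tensor identities (invariance under `L`, under
  `B`-orthogonal automorphisms, symmetry) of the canonical tensor `∑ᵢ bᵢ ⊗ bⁱ` of a
  non-degenerate symmetric invariant form, from `CasimirElement`
  (Bourbaki, LIE I §3.7, Prop. 11).

With `σ = ρ_V ⊗ 1` and `σ = 1 ⊗ ρ_E` on a tensor product `V ⊗ E` and a SYMMETRIC invariant tensor
this gives `H(C_V ⊗ 1) = H(1 ⊗ C_E)` on `H^•(𝔤, K; V ⊗ E)` for the Casimir operators `C` of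
invariant forms — Wigner's lemma for quadratic Casimir elements without `Ext`
(`Literature.NumberTheory.Automorphic.GKCohomologyCasimir`).

## References

* C. Chevalley, S. Eilenberg, *Cohomology theory of Lie groups and Lie algebras*, Trans. AMS 63
  (1948), §23–§24 (Thm. 24.1 and its proof). [ChevalleyEilenberg1948]
* A. Borel, N. Wallach, *Continuous cohomology, discrete subgroups, and representations of
  reductive groups*, 2nd ed. (2000), I §1.1 (5), §5.1. [BorelWallach2000]
* N. Bourbaki, *Lie Groups and Lie Algebras* I, §3.7.
-/

-- Mathlib idiom (Mathlib/Algebra/Lie/OfAssociative.lean): the commutator bracket on `Module.End R M`,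
-- the codomain of `LieModule.toEnd`.
attribute [local instance 100] LieRing.ofAssociativeRing

open scoped TensorProduct

namespace Literature.Algebra.Lie.ChevalleyEilenberg

variable {R : Type*} [CommRing R] {L : Type*} [LieRing L] [LieAlgebra R L]
  {M : Type*} [AddCommGroup M] [Module R M] [LieRingModule L M] [LieModule R L M]

/-! ### Post-composition with an arbitrary endomorphism of the values -/

omit [LieRingModule L M] [LieModule R L M] in
/-- `post` is additive in the linear map. [folklore] -/
theorem post_add (ψ ψ' : M →ₗ[R] M) (q : ℕ) (f : Cochain R L M q) :
    post L (ψ + ψ') q f = post L ψ q f + post L ψ' q f := by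
  ext v; rfl

omit [LieRingModule L M] [LieModule R L M] in
/-- `post` of a finite sum of linear maps. [folklore] -/
theorem post_sum {ι : Type*} (s : Finset ι) (ψ : ι → M →ₗ[R] M) (q : ℕ) (f : Cochain R L M q) :
    post L (∑ i ∈ s, ψ i) q f = ∑ i ∈ s, post L (ψ i) q f := by
  classical
  induction s using Finset.induction_on with
  | empty => ext v; simp
  | insert a s ha ih => rw [Finset.sum_insert ha, Finset.sum_insert ha, post_add, ih]

omit [LieRingModule L M] [LieModule R L M] in
/-- `post 0 = 0`. [folklore] -/
theorem post_zero (q : ℕ) (f : Cochain R L M q) : post L (0 : M →ₗ[R] M) q f = 0 := by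
  ext v; rfl

omit [LieRingModule L M] [LieModule R L M] in
/-- `post` of a negated map. [folklore] -/
theorem post_neg (ψ : M →ₗ[R] M) (q : ℕ) (f : Cochain R L M q) :
    post L (-ψ) q f = -post L ψ q f := by
  ext v; rfl

omit [LieRingModule L M] [LieModule R L M] in
/-- `post` of a difference. [folklore] -/
theorem post_sub (ψ ψ' : M →ₗ[R] M) (q : ℕ) (f : Cochain R L M q) :
    post L (ψ - ψ') q f = post L ψ q f - post L ψ' q f := by
  ext v; rfl

omit [LieRingModule L M] [LieModule R L M] in
/-- `post (ψ ∘ ψ') = post ψ ∘ post ψ'`. [folklore] -/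
theorem post_mul (ψ ψ' : M →ₗ[R] M) (q : ℕ) (f : Cochain R L M q) :
    post L (ψ * ψ') q f = post L ψ q (post L ψ' q f) := by
  ext v; rfl

/-- In degree `0`, post-composition with the action of `y` is the Lie derivative `θ_y`.
[cite: ChevalleyEilenberg1948, §23 (23.3)] -/
theorem post_toEnd_zero (y : L) (f : Cochain R L M 0) :
    post L (LieModule.toEnd R L M y) 0 f = lieDer R L M 0 y f := by
  ext v; rfl

/-- **The Lie derivative of a post-composed cochain**: for an arbitrary linear `ψ : M → M`,
`θ_x (ψ ∘ f) = ψ ∘ θ_x f + [ρ(x), ψ] ∘ f` (the defect is post-composition with the commutator of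
`ψ` with the action of `x`; for `ψ` commuting with `ρ(x)` this is `lieDer_post_of_comm`).
[cite: ChevalleyEilenberg1948, §23 (23.5)] -/
theorem lieDer_post (ψ : M →ₗ[R] M) (x : L) :
    ∀ (q : ℕ) (f : Cochain R L M q),
      lieDer R L M q x (post L ψ q f) =
        post L ψ q (lieDer R L M q x f) +
          post L (LieModule.toEnd R L M x * ψ - ψ * LieModule.toEnd R L M x) q f
  | 0, f => by
    ext v
    simp only [lieDer_zero_apply, post_apply, AlternatingMap.add_apply, LinearMap.sub_apply,
      Module.End.mul_apply, LieModule.toEnd_apply_apply]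
    abel
  | q + 1, f => by
    refine ext_ins fun y => ?_
    simp only [map_add, map_sub, ins_lieDer, ins_post, lieDer_post ψ x q]
    abel

/-! ### The Casimir homotopy of an invariant tensor -/

section Casimir

variable {ι : Type*} [Fintype ι] (σ : L →ₗ[R] Module.End R M) (y y' : ι → L)

/-- **The Casimir homotopy** `h f = ∑_s σ(y_s) ∘ i_{y'_s} f : C^{q+1} → C^q` attached to a linear
map `σ : L → End M` and a finite family of pairs `(y_s, y'_s)` in `L` (for `σ = ρ` and
`∑ y_s ⊗ y'_s` the canonical tensor of an invariant form: the homotopy of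
[cite: ChevalleyEilenberg1948, §24] showing that the Casimir operator kills cohomology). -/
def casimirHomotopy (q : ℕ) : Cochain R L M (q + 1) →ₗ[R] Cochain R L M q :=
  ∑ s, post L (σ (y s)) q ∘ₗ ins q (y' s)

omit [LieRingModule L M] [LieModule R L M] in
/-- Unfolding. [folklore] -/
theorem casimirHomotopy_apply (q : ℕ) (f : Cochain R L M (q + 1)) :
    casimirHomotopy σ y y' q f = ∑ s, post L (σ (y s)) q (ins q (y' s) f) := by
  simp [casimirHomotopy]

/-- **The Casimir-type operator** `N = ∑_s σ(y_s) ρ(y'_s) ∈ End M`.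
[cite: ChevalleyEilenberg1948, §24] -/
def casimirOp : Module.End R M := ∑ s, σ (y s) * LieModule.toEnd R L M (y' s)

/-- Unfolding. [folklore] -/
theorem casimirOp_apply (m : M) : casimirOp σ y y' m = ∑ s, σ (y s) ⁅y' s, m⁆ := by
  simp [casimirOp]

omit [LieRingModule L M] [LieModule R L M] in
/-- Insertions anticommute with the homotopy: `i_x h = - h i_x`. [folklore] -/
theorem ins_casimirHomotopy (q : ℕ) (x : L) (f : Cochain R L M (q + 2)) :
    ins q x (casimirHomotopy σ y y' (q + 1) f) = -casimirHomotopy σ y y' q (ins (q + 1) x f) := by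
  simp only [casimirHomotopy_apply, map_sum, ins_post, ins_ins q x, map_neg,
    Finset.sum_neg_distrib]

/-- In degree `0`: `h (d f) = N ∘ f`. [cite: ChevalleyEilenberg1948, §24] -/
theorem casimirHomotopy_d_zero (f : Cochain R L M 0) :
    casimirHomotopy σ y y' 0 (d R L M 0 f) = post L (casimirOp σ y y') 0 f := by
  simp only [casimirHomotopy_apply, ins_d_zero, ← post_toEnd_zero, ← post_mul, casimirOp,
    post_sum]

variable {σ y y'}

omit [LieRingModule L M] [LieModule R L M] in
/-- The bilinear identity obtained from a tensor identity. [folklore] -/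
theorem sum_bilin_eq_zero_of_tensor {N : Type*} [AddCommGroup N] [Module R N]
    (Φ : L →ₗ[R] L →ₗ[R] N) {x : L}
    (hT : ∑ s, (⁅x, y s⁆ ⊗ₜ[R] y' s + y s ⊗ₜ[R] ⁅x, y' s⁆) = (0 : L ⊗[R] L)) :
    ∑ s, (Φ ⁅x, y s⁆ (y' s) + Φ (y s) ⁅x, y' s⁆) = 0 := by
  have h := congrArg (TensorProduct.lift Φ) hT
  simpa only [map_sum, map_add, TensorProduct.lift.tmul, map_zero] using h

omit [LieRingModule L M] [LieModule R L M] in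
/-- The bilinear identity obtained from an equality of tensors. [folklore] -/
theorem sum_bilin_eq_of_tensor_eq {N : Type*} [AddCommGroup N] [Module R N]
    (Φ : L →ₗ[R] L →ₗ[R] N) {z z' : ι → L}
    (hT : ∑ s, z s ⊗ₜ[R] z' s = ∑ s, y s ⊗ₜ[R] y' s) :
    ∑ s, Φ (z s) (z' s) = ∑ s, Φ (y s) (y' s) := by
  have h := congrArg (TensorProduct.lift Φ) hT
  simpa only [map_sum, TensorProduct.lift.tmul] using h

/-- The bilinear map `(u, v) ↦ σ(u) ∘ i_v f`. [folklore] -/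
def postInsBilin (q : ℕ) (f : Cochain R L M (q + 1)) : L →ₗ[R] L →ₗ[R] Cochain R L M q :=
  LinearMap.mk₂ R (fun u v => post L (σ u) q (ins q v f))
    (fun u u' v => by rw [map_add, post_add])
    (fun c u v => by ext w; simp)
    (fun u v v' => by rw [ins_add, map_add])
    (fun c u v => by rw [ins_smul, map_smul])

omit [LieRingModule L M] [LieModule R L M] in
/-- Unfolding. [folklore] -/
@[simp] theorem postInsBilin_apply (q : ℕ) (f : Cochain R L M (q + 1)) (u v : L) :
    postInsBilin (σ := σ) q f u v = post L (σ u) q (ins q v f) := rfl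

/-- **The Lie derivative commutes with the Casimir homotopy** when `σ` is equivariant
(`[ρ(x), σ(u)] = σ([x, u])`) and the tensor `∑ y_s ⊗ y'_s` is invariant under `x`.
[cite: ChevalleyEilenberg1948, §24] -/
theorem lieDer_casimirHomotopy
    (hσ : ∀ x u : L, LieModule.toEnd R L M x * σ u - σ u * LieModule.toEnd R L M x = σ ⁅x, u⁆)
    {x : L} (hT : ∑ s, (⁅x, y s⁆ ⊗ₜ[R] y' s + y s ⊗ₜ[R] ⁅x, y' s⁆) = (0 : L ⊗[R] L))
    (q : ℕ) (f : Cochain R L M (q + 1)) :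
    lieDer R L M q x (casimirHomotopy σ y y' q f) =
      casimirHomotopy σ y y' q (lieDer R L M (q + 1) x f) := by
  have hins : ∀ s, lieDer R L M q x (ins q (y' s) f) =
      ins q (y' s) (lieDer R L M (q + 1) x f) + ins q ⁅x, y' s⁆ f := fun s => by
    rw [ins_lieDer, sub_add_cancel]
  have key := sum_bilin_eq_zero_of_tensor (postInsBilin (σ := σ) q f) hT
  simp only [postInsBilin_apply] at key
  simp only [casimirHomotopy_apply, map_sum, lieDer_post, hσ, hins, map_add]
  rw [← sub_eq_zero, ← Finset.sum_sub_distrib, ← key]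
  refine Finset.sum_congr rfl fun s _ => ?_
  abel

/-- **The Casimir homotopy identity** `d h + h d = N ∘ -` on cochains of positive degree:
post-composition with `N = ∑_s σ(y_s) ρ(y'_s)` is null-homotopic.
[cite: ChevalleyEilenberg1948, §24] -/
theorem d_casimirHomotopy_add
    (hσ : ∀ x u : L, LieModule.toEnd R L M x * σ u - σ u * LieModule.toEnd R L M x = σ ⁅x, u⁆)
    (hT : ∀ x : L, ∑ s, (⁅x, y s⁆ ⊗ₜ[R] y' s + y s ⊗ₜ[R] ⁅x, y' s⁆) = (0 : L ⊗[R] L)) :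
    ∀ (q : ℕ) (f : Cochain R L M (q + 1)),
      d R L M q (casimirHomotopy σ y y' q f) +
          casimirHomotopy σ y y' (q + 1) (d R L M (q + 1) f) =
        post L (casimirOp σ y y') (q + 1) f
  | 0, f => by
    refine ext_ins fun x => ?_
    rw [map_add, ins_d_zero, lieDer_casimirHomotopy hσ (hT x), ins_casimirHomotopy, ins_d_succ,
      map_sub, casimirHomotopy_d_zero, ins_post]
    abel
  | q + 1, f => by
    refine ext_ins fun x => ?_
    rw [map_add, ins_d_succ, lieDer_casimirHomotopy hσ (hT x), ins_casimirHomotopy, map_neg,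
      ins_casimirHomotopy, ins_d_succ, map_sub, ins_post,
      ← d_casimirHomotopy_add hσ hT q (ins (q + 1) x f)]
    abel

/-- **`N` is a morphism of `L`-modules** (`[ρ(x), N] = 0`, by equivariance of `σ` and invariance
of the tensor). [cite: ChevalleyEilenberg1948, §24] -/
theorem toEnd_mul_casimirOp
    (hσ : ∀ x u : L, LieModule.toEnd R L M x * σ u - σ u * LieModule.toEnd R L M x = σ ⁅x, u⁆)
    {x : L} (hT : ∑ s, (⁅x, y s⁆ ⊗ₜ[R] y' s + y s ⊗ₜ[R] ⁅x, y' s⁆) = (0 : L ⊗[R] L)) :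
    LieModule.toEnd R L M x * casimirOp σ y y' = casimirOp σ y y' * LieModule.toEnd R L M x := by
  -- the bilinear map `(u, v) ↦ σ(u) ρ(v)`
  let Φ : L →ₗ[R] L →ₗ[R] Module.End R M :=
    LinearMap.mk₂ R (fun u v => σ u * LieModule.toEnd R L M v)
      (fun u u' v => by rw [map_add, add_mul])
      (fun c u v => by rw [map_smul, smul_mul_assoc])
      (fun u v v' => by rw [map_add, mul_add])
      (fun c u v => by rw [map_smul, mul_smul_comm])
  have key := sum_bilin_eq_zero_of_tensor Φ hT
  simp only [Φ, LinearMap.mk₂_apply] at key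
  have h1 : ∀ s, LieModule.toEnd R L M x * (σ (y s) * LieModule.toEnd R L M (y' s)) =
      σ (y s) * LieModule.toEnd R L M (y' s) * LieModule.toEnd R L M x +
        (σ ⁅x, y s⁆ * LieModule.toEnd R L M (y' s) + σ (y s) * LieModule.toEnd R L M ⁅x, y' s⁆) := by
    intro s
    have e1 : LieModule.toEnd R L M x * σ (y s) = σ (y s) * LieModule.toEnd R L M x + σ ⁅x, y s⁆ := by
      rw [← hσ x (y s)]; abel
    have e2 : LieModule.toEnd R L M x * LieModule.toEnd R L M (y' s) =
        LieModule.toEnd R L M (y' s) * LieModule.toEnd R L M x + LieModule.toEnd R L M ⁅x, y' s⁆ := by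
      rw [LieHom.map_lie, Ring.lie_def]; abel
    rw [← mul_assoc, e1, add_mul, mul_assoc, e2, mul_add, ← mul_assoc]
    abel
  simp only [casimirOp, Finset.mul_sum, Finset.sum_mul, h1, Finset.sum_add_distrib, key, add_zero]

end Casimir


/-! ### The `(𝔤, K)`-complex is preserved and the Casimir operator kills its cohomology -/

section GK

variable {Γ : Type*} [Group Γ] {ι : Type*} [Fintype ι] {σ : L →ₗ[R] Module.End R M}
  {y y' : ι → L}

/-- The Casimir homotopy preserves relative cochains. [cite: BorelWallach2000, I §1.2] -/
theorem casimirHomotopy_mem_rel (K : LieSubalgebra R L)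
    (hσ : ∀ x u : L, LieModule.toEnd R L M x * σ u - σ u * LieModule.toEnd R L M x = σ ⁅x, u⁆)
    (hT : ∀ x : L, ∑ s, (⁅x, y s⁆ ⊗ₜ[R] y' s + y s ⊗ₜ[R] ⁅x, y' s⁆) = (0 : L ⊗[R] L))
    (q : ℕ) (f : Cochain R L M (q + 1)) (hf : f ∈ (Subcomplex.rel R L M K).carrier (q + 1)) :
    casimirHomotopy σ y y' q f ∈ (Subcomplex.rel R L M K).carrier q := by
  rw [Subcomplex.mem_rel_succ_iff] at hf
  cases q with
  | zero =>
    rw [Subcomplex.mem_rel_zero_iff]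
    intro x hx
    rw [lieDer_casimirHomotopy hσ (hT x), (hf x hx).1, map_zero]
  | succ q =>
    rw [Subcomplex.mem_rel_succ_iff]
    intro x hx
    refine ⟨?_, ?_⟩
    · rw [lieDer_casimirHomotopy hσ (hT x), (hf x hx).1, map_zero]
    · rw [ins_casimirHomotopy, (hf x hx).2, map_zero, neg_zero]

omit [LieModule R L M] in
/-- `g • (σ(u) ∘ f) = σ(σ_g u) ∘ (g • f)` when `σ` is `Γ`-equivariant. [folklore] -/
theorem act_post_of_equivariant (A : PairAction R L M Γ)
    (hσK : ∀ (g : Γ) (u : L), A.τ g ∘ₗ σ u = σ (A.σ g u) ∘ₗ A.τ g) (g : Γ) (q : ℕ) (u : L)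
    (f : Cochain R L M q) :
    A.act g q (post L (σ u) q f) = post L (σ (A.σ g u)) q (A.act g q f) := by
  ext v
  simp only [PairAction.act_apply, post_apply]
  exact LinearMap.congr_fun (hσK g u) _

omit [LieModule R L M] in
/-- `g • (i_v f) = i_{σ_g v} (g • f)`. [folklore] -/
theorem act_ins (A : PairAction R L M Γ) (g : Γ) (q : ℕ) (v : L) (f : Cochain R L M (q + 1)) :
    A.act g q (ins q v f) = ins q (A.σ g v) (A.act g (q + 1) f) := by
  rw [PairAction.ins_act, A.σ_apply_inv]

omit [LieModule R L M] in
/-- The group action commutes with the Casimir homotopy when `σ` is equivariant and the tensor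
`∑ y_s ⊗ y'_s` is `Γ`-invariant. [cite: BorelWallach2000, I §5.1] -/
theorem act_casimirHomotopy (A : PairAction R L M Γ)
    (hσK : ∀ (g : Γ) (u : L), A.τ g ∘ₗ σ u = σ (A.σ g u) ∘ₗ A.τ g) {g : Γ}
    (hTK : ∑ s, A.σ g (y s) ⊗ₜ[R] A.σ g (y' s) = ∑ s, y s ⊗ₜ[R] y' s)
    (q : ℕ) (f : Cochain R L M (q + 1)) :
    A.act g q (casimirHomotopy σ y y' q f) = casimirHomotopy σ y y' q (A.act g (q + 1) f) := by
  have key := sum_bilin_eq_of_tensor_eq (y := y) (y' := y')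
    (postInsBilin (σ := σ) q (A.act g (q + 1) f)) (z := fun s => A.σ g (y s))
    (z' := fun s => A.σ g (y' s)) hTK
  simp only [postInsBilin_apply] at key
  simp only [casimirHomotopy_apply, map_sum, act_post_of_equivariant A hσK, act_ins A g q]
  exact key

/-- **The Casimir homotopy preserves the `(𝔤, K)`-complex.** [cite: BorelWallach2000, I §5.1] -/
theorem casimirHomotopy_mem_gK (K : LieSubalgebra R L) (A : PairAction R L M Γ)
    (hσ : ∀ x u : L, LieModule.toEnd R L M x * σ u - σ u * LieModule.toEnd R L M x = σ ⁅x, u⁆)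
    (hT : ∀ x : L, ∑ s, (⁅x, y s⁆ ⊗ₜ[R] y' s + y s ⊗ₜ[R] ⁅x, y' s⁆) = (0 : L ⊗[R] L))
    (hσK : ∀ (g : Γ) (u : L), A.τ g ∘ₗ σ u = σ (A.σ g u) ∘ₗ A.τ g)
    (hTK : ∀ g : Γ, ∑ s, A.σ g (y s) ⊗ₜ[R] A.σ g (y' s) = ∑ s, y s ⊗ₜ[R] y' s)
    (q : ℕ) (f : Cochain R L M (q + 1)) (hf : f ∈ (Subcomplex.gK R L M K A).carrier (q + 1)) :
    casimirHomotopy σ y y' q f ∈ (Subcomplex.gK R L M K A).carrier q := by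
  rw [Subcomplex.mem_gK_iff] at hf ⊢
  exact ⟨casimirHomotopy_mem_rel K hσ hT q f hf.1, fun g => by
    rw [act_casimirHomotopy A hσK (hTK g), hf.2 g]⟩

variable (σ y y') in
/-- **The Casimir operator `N = ∑_s σ(y_s) ρ(y'_s)` as an endomorphism of the `L`-module `M`.**
[cite: ChevalleyEilenberg1948, §24] -/
def casimirEndo
    (hσ : ∀ x u : L, LieModule.toEnd R L M x * σ u - σ u * LieModule.toEnd R L M x = σ ⁅x, u⁆)
    (hT : ∀ x : L, ∑ s, (⁅x, y s⁆ ⊗ₜ[R] y' s + y s ⊗ₜ[R] ⁅x, y' s⁆) = (0 : L ⊗[R] L)) :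
    M →ₗ⁅R,L⁆ M :=
  { casimirOp σ y y' with
    map_lie' := fun {x m} => by
      have h := LinearMap.congr_fun (toEnd_mul_casimirOp hσ (hT x)) m
      simp only [Module.End.mul_apply, LieModule.toEnd_apply_apply] at h
      exact h.symm }

/-- Unfolding. [folklore] -/
@[simp] theorem casimirEndo_apply (hσ) (hT) (m : M) :
    casimirEndo σ y y' hσ hT m = casimirOp σ y y' m := rfl

/-- On cochains, `N_*` is post-composition with `N`. [folklore] -/
theorem map_casimirEndo (hσ) (hT) (q : ℕ) (f : Cochain R L M q) :
    map L (casimirEndo σ y y' hσ hT) q f = post L (casimirOp σ y y') q f := by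
  ext v; rfl

/-- `N` commutes with the group action (equivariance of `σ`, `Γ`-invariance of the tensor and
compatibility of the pair action). [cite: BorelWallach2000, I §5.1] -/
theorem tau_comp_casimirOp (A : PairAction R L M Γ)
    (hσK : ∀ (g : Γ) (u : L), A.τ g ∘ₗ σ u = σ (A.σ g u) ∘ₗ A.τ g) {g : Γ}
    (hTK : ∑ s, A.σ g (y s) ⊗ₜ[R] A.σ g (y' s) = ∑ s, y s ⊗ₜ[R] y' s) :
    A.τ g ∘ₗ casimirOp σ y y' = casimirOp σ y y' ∘ₗ A.τ g := by
  let Φ : L →ₗ[R] L →ₗ[R] Module.End R M :=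
    LinearMap.mk₂ R (fun u v => σ u * LieModule.toEnd R L M v)
      (fun u u' v => by rw [map_add, add_mul])
      (fun c u v => by rw [map_smul, smul_mul_assoc])
      (fun u v v' => by rw [map_add, mul_add])
      (fun c u v => by rw [map_smul, mul_smul_comm])
  have key := sum_bilin_eq_of_tensor_eq (y := y) (y' := y') Φ (z := fun s => A.σ g (y s))
    (z' := fun s => A.σ g (y' s)) hTK
  simp only [Φ, LinearMap.mk₂_apply] at key
  have hτ : ∀ v : L, A.τ g * LieModule.toEnd R L M v = LieModule.toEnd R L M (A.σ g v) * A.τ g :=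
    fun v => LinearMap.ext fun m => A.compat g v m
  have hσK' : ∀ u : L, A.τ g * σ u = σ (A.σ g u) * A.τ g := fun u => hσK g u
  have h1 : ∀ s, A.τ g * (σ (y s) * LieModule.toEnd R L M (y' s)) =
      σ (A.σ g (y s)) * LieModule.toEnd R L M (A.σ g (y' s)) * A.τ g := by
    intro s
    rw [← mul_assoc, hσK', mul_assoc, hτ, ← mul_assoc]
  change A.τ g * ∑ s, σ (y s) * LieModule.toEnd R L M (y' s) =
    (∑ s, σ (y s) * LieModule.toEnd R L M (y' s)) * A.τ g
  rw [Finset.mul_sum]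
  simp only [h1]
  rw [← Finset.sum_mul, key]

/-- The hypothesis of `gKCohomologyMap` for the Casimir operator. [folklore] -/
theorem tau_comp_casimirEndo (A : PairAction R L M Γ) (hσ) (hT)
    (hσK : ∀ (g : Γ) (u : L), A.τ g ∘ₗ σ u = σ (A.σ g u) ∘ₗ A.τ g)
    (hTK : ∀ g : Γ, ∑ s, A.σ g (y s) ⊗ₜ[R] A.σ g (y' s) = ∑ s, y s ⊗ₜ[R] y' s) (g : Γ) :
    (A.τ g).comp (casimirEndo σ y y' hσ hT : M →ₗ[R] M) =
      (casimirEndo σ y y' hσ hT : M →ₗ[R] M).comp (A.τ g) :=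
  tau_comp_casimirOp A hσK (hTK g)

/-- **The Casimir operator kills `(𝔤, K)`-cohomology**: the endomorphism of `H^q(𝔤, 𝔨, K; M)`
induced by `N = ∑_s σ(y_s) ρ(y'_s)` vanishes in every degree (for `σ = ρ` and the canonical
tensor of an invariant form, Chevalley–Eilenberg's theorem that the Casimir operator acts by
zero on `H^•(L; M)`). [cite: ChevalleyEilenberg1948, §24] -/
theorem gKCohomologyMap_casimirEndo_eq_zero (K : LieSubalgebra R L) (A : PairAction R L M Γ)
    (hσ : ∀ x u : L, LieModule.toEnd R L M x * σ u - σ u * LieModule.toEnd R L M x = σ ⁅x, u⁆)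
    (hT : ∀ x : L, ∑ s, (⁅x, y s⁆ ⊗ₜ[R] y' s + y s ⊗ₜ[R] ⁅x, y' s⁆) = (0 : L ⊗[R] L))
    (hσK : ∀ (g : Γ) (u : L), A.τ g ∘ₗ σ u = σ (A.σ g u) ∘ₗ A.τ g)
    (hTK : ∀ g : Γ, ∑ s, A.σ g (y s) ⊗ₜ[R] A.σ g (y' s) = ∑ s, y s ⊗ₜ[R] y' s)
    (q : ℕ) (x : gKCohomology R L M K A q) :
    gKCohomologyMap K A (casimirEndo σ y y' hσ hT) (tau_comp_casimirEndo A hσ hT hσK hTK) q x =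
      0 := by
  obtain ⟨z, rfl⟩ := (Subcomplex.gK R L M K A).toCohomology_surjective q x
  rw [gKCohomologyMap_toCohomology, Subcomplex.toCohomology_eq_zero_iff,
    Subcomplex.IsCochainMapTo.coe_cocyclesMap, map_casimirEndo]
  have hz := ((Subcomplex.gK R L M K A).mem_cocycles_iff q _).1 z.2
  cases q with
  | zero =>
    rw [← casimirHomotopy_d_zero, hz.2, map_zero]
    exact Submodule.zero_mem _
  | succ q =>
    rw [Subcomplex.mem_coboundaries_succ_iff]
    refine ⟨casimirHomotopy σ y y' q z, casimirHomotopy_mem_gK K A hσ hT hσK hTK q z hz.1, ?_⟩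
    have h := d_casimirHomotopy_add hσ hT q (z : Cochain R L M (q + 1))
    rwa [hz.2, map_zero, add_zero] at h

end GK

/-! ### Central elements of `L`: `θ_z = ρ(z) ∘ -` is null-homotopic (Cartan) -/

section Central

variable {Γ : Type*} [Group Γ]

/-- For `z` central in `L`, the Lie derivative `θ_z` is post-composition with `ρ(z)`.
[cite: ChevalleyEilenberg1948, §23 (23.3)] -/
theorem lieDer_eq_post_toEnd_of_central {z : L} (hz : ∀ x : L, ⁅z, x⁆ = 0) :
    ∀ (q : ℕ) (f : Cochain R L M q),
      lieDer R L M q z f = post L (LieModule.toEnd R L M z) q f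
  | 0, f => by ext v; rfl
  | q + 1, f => ext_ins fun x => by
    rw [ins_lieDer, hz, ins_zero_left, sub_zero, lieDer_eq_post_toEnd_of_central hz q, ins_post]

/-- `i_z` preserves the `(𝔤, K)`-complex for `z` central and `Γ`-fixed. [folklore] -/
theorem ins_mem_gK_of_central (K : LieSubalgebra R L) (A : PairAction R L M Γ) {z : L}
    (hz : ∀ x : L, ⁅z, x⁆ = 0) (hzK : ∀ g : Γ, A.σ g z = z) (q : ℕ) (f : Cochain R L M (q + 1))
    (hf : f ∈ (Subcomplex.gK R L M K A).carrier (q + 1)) :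
    ins q z f ∈ (Subcomplex.gK R L M K A).carrier q := by
  rw [Subcomplex.mem_gK_iff] at hf ⊢
  rw [Subcomplex.mem_rel_succ_iff] at hf
  have hlie : ∀ x ∈ K, lieDer R L M q x (ins q z f) = 0 := fun x hx => by
    have h := ins_lieDer q x z f
    rw [(hf.1 x hx).1, map_zero, ← lie_skew, hz, neg_zero, ins_zero_left, sub_zero] at h
    exact h.symm
  refine ⟨?_, fun g => by rw [act_ins, hzK, hf.2 g]⟩
  cases q with
  | zero => exact (Subcomplex.mem_rel_zero_iff K _).2 hlie
  | succ q =>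
    exact (Subcomplex.mem_rel_succ_iff K q _).2 fun x hx =>
      ⟨hlie x hx, by rw [ins_ins, (hf.1 x hx).2, map_zero, neg_zero]⟩

variable (R M) in
/-- The action of a central `z ∈ L` as an endomorphism of the `L`-module `M`. [folklore] -/
def centralEndo (z : L) (hz : ∀ x : L, ⁅z, x⁆ = 0) : M →ₗ⁅R,L⁆ M :=
  { LieModule.toEnd R L M z with
    map_lie' := fun {x m} => by
      change ⁅z, ⁅x, m⁆⁆ = ⁅x, ⁅z, m⁆⁆
      rw [leibniz_lie, hz, zero_lie, zero_add] }

/-- Unfolding. [folklore] -/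
@[simp] theorem centralEndo_apply (z : L) (hz : ∀ x : L, ⁅z, x⁆ = 0) (m : M) :
    centralEndo R M z hz m = ⁅z, m⁆ := rfl

/-- A central `Γ`-fixed `z` acts compatibly with the group. [folklore] -/
theorem tau_comp_centralEndo (A : PairAction R L M Γ) {z : L} (hz : ∀ x : L, ⁅z, x⁆ = 0)
    (hzK : ∀ g : Γ, A.σ g z = z) (g : Γ) :
    (A.τ g).comp (centralEndo R M z hz : M →ₗ[R] M) =
      (centralEndo R M z hz : M →ₗ[R] M).comp (A.τ g) := by
  ext m
  change A.τ g ⁅z, m⁆ = ⁅z, A.τ g m⁆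
  rw [A.compat, hzK]

/-- **A central element of `L` acts by zero on `(𝔤, K)`-cohomology**: `θ_z = ρ(z) ∘ -` on
cochains, and `θ_z = i_z d + d i_z` (Cartan). [cite: BorelWallach2000, I §1.1 (5)] -/
theorem gKCohomologyMap_centralEndo_eq_zero (K : LieSubalgebra R L) (A : PairAction R L M Γ)
    {z : L} (hz : ∀ x : L, ⁅z, x⁆ = 0) (hzK : ∀ g : Γ, A.σ g z = z) (q : ℕ)
    (x : gKCohomology R L M K A q) :
    gKCohomologyMap K A (centralEndo R M z hz) (tau_comp_centralEndo A hz hzK) q x = 0 := by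
  obtain ⟨w, rfl⟩ := (Subcomplex.gK R L M K A).toCohomology_surjective q x
  rw [gKCohomologyMap_toCohomology, Subcomplex.toCohomology_eq_zero_iff,
    Subcomplex.IsCochainMapTo.coe_cocyclesMap]
  have hw := ((Subcomplex.gK R L M K A).mem_cocycles_iff q _).1 w.2
  have hmap : map L (centralEndo R M z hz) q (w : Cochain R L M q) = lieDer R L M q z w := by
    rw [lieDer_eq_post_toEnd_of_central hz]; ext v; rfl
  rw [hmap]
  cases q with
  | zero =>
    rw [lieDer_zero_eq_ins_d, hw.2, map_zero]
    exact Submodule.zero_mem _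
  | succ q =>
    rw [Subcomplex.mem_coboundaries_succ_iff]
    refine ⟨ins q z w, ins_mem_gK_of_central K A hz hzK q w hw.1, ?_⟩
    rw [lieDer_eq_ins_d_add_d_ins, hw.2, map_zero, zero_add]

end Central

end Literature.Algebra.Lie.ChevalleyEilenberg

/-! ### The canonical tensor of a non-degenerate invariant symmetric form -/

namespace Literature.Algebra.Lie

variable {𝕜 : Type*} [Field 𝕜] {𝔤 : Type*} [LieRing 𝔤] [LieAlgebra 𝕜 𝔤]
  {κ : Type*} [Fintype κ] [DecidableEq κ] {B : LinearMap.BilinForm 𝕜 𝔤}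
  (hB : B.Nondegenerate) (hBs : B.IsSymm)

include hBs in
/-- **The canonical tensor `∑ᵢ bᵢ ⊗ bⁱ` of a non-degenerate invariant symmetric form is
`𝔤`-invariant**: `∑ᵢ ([x, bᵢ] ⊗ bⁱ + bᵢ ⊗ [x, bⁱ]) = 0`. Bourbaki, LIE I §3.7, Prop. 11.
[folklore] -/
theorem sum_lie_basis_tmul_dualBasis_add (hBi : B.lieInvariant 𝔤) (b : Module.Basis κ 𝕜 𝔤)
    (x : 𝔤) :
    ∑ i, (⁅x, b i⁆ ⊗ₜ[𝕜] B.dualBasis hB b i + b i ⊗ₜ[𝕜] ⁅x, B.dualBasis hB b i⁆) =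
      (0 : 𝔤 ⊗[𝕜] 𝔤) := by
  rw [Finset.sum_add_distrib]
  have h := sum_lie_basis_dualBasis_eq_neg hB hBs hBi (TensorProduct.mk 𝕜 𝔤 𝔤) b x
  simp only [TensorProduct.mk_apply] at h
  rw [h, neg_add_cancel]

include hBs in
/-- **… and invariant under `B`-orthogonal automorphisms** (e.g. `Ad g`):
`∑ᵢ e bᵢ ⊗ e bⁱ = ∑ᵢ bᵢ ⊗ bⁱ`. Knapp 2002, V.§4. [folklore] -/
theorem sum_map_basis_tmul_dualBasis (b : Module.Basis κ 𝕜 𝔤) (e : 𝔤 ≃ₗ[𝕜] 𝔤)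
    (he : ∀ x y, B (e x) (e y) = B x y) :
    ∑ i, e (b i) ⊗ₜ[𝕜] e (B.dualBasis hB b i) = ∑ i, b i ⊗ₜ[𝕜] B.dualBasis hB b i := by
  have h := sum_map_basis_dualBasis_eq hB hBs (TensorProduct.mk 𝕜 𝔤 𝔤) b e he
  simpa only [TensorProduct.mk_apply] using h

include hBs in
/-- **… and symmetric**: `∑ᵢ bⁱ ⊗ bᵢ = ∑ᵢ bᵢ ⊗ bⁱ` (the dual basis of the dual basis is `b`).
[folklore] -/
theorem sum_dualBasis_tmul_basis (b : Module.Basis κ 𝕜 𝔤) :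
    ∑ i, B.dualBasis hB b i ⊗ₜ[𝕜] b i = ∑ i, b i ⊗ₜ[𝕜] B.dualBasis hB b i := by
  have h := sum_basis_dualBasis_eq hB hBs (TensorProduct.mk 𝕜 𝔤 𝔤) (B.dualBasis hB b) b
  rw [LinearMap.BilinForm.dualBasis_dualBasis hB hBs b] at h
  simpa only [TensorProduct.mk_apply] using h

end Literature.Algebra.Lie
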